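import Literature.MathematicalPhysics.QuantumFieldTheory.Rivasseau1991.DangerousForestsLocality
import HarnessLib

/-!
# AHKN's q-type diagrams (vertices on one lepton path + a photon pairing), their UV-divergent subdiagrams as SEGMENTS (§6.1) with the printed segment inclusion relations (§6.2), and — PROVED for every q-type diagram and every ordering of its lines — Rivasseau's Classification of Forests and the regrouped forest formula (II.3.19)

HONEST FRAMING (venture `QEDPrecision`, cell `qed-hepp`, seat `qed-hepp-lit` gen 2; VALUE-FREE: finite combinatorics of line sets of a word — no
integral, no amplitude, no number of any Set-V family; tenth order stays BLIND). Estimator-programme context: the cell regroups the AHKN K-forest sum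
of each Set-V word per Hepp ordering by Rivasseau's classification (HOME `run/shared/lean/pub/qed-hepp/PLAN.md` §3, theory seat T0). The seat's
chain `Zimmermann1969.ForestFormulaRegrouping` → `Rivasseau1991.ClassificationOfForests` → `Rivasseau1991.DangerousForests` →
`Rivasseau1991.DangerousForestsLocality` ends in `forestSum_eq_sum_safe_of_system` / `sum_orderedNegProd_eq_sum_safe_of_system`, which hold for
every admissible family `A` that is a `SubgraphSystem G ext A` (six structural facts H1–H6 the printed proofs use). THIS file types the diagram
model those words denote, exactly as AHKN print it, and PROVES H1–H6 once and for all for it — so (II.3.19) holds for EVERY q-type diagram, every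
subfamily of its UV-divergent subdiagrams, and every index `pos` on its lines, with no per-word hypothesis left (the cell's per-word six-check
census becomes a cross-check of its tables, not a dependency).

SOURCES, AS PRINTED (`lit read paper:arxiv-hep-ph_0512288`, LaTeX-derived chunks pNNNN:Lk; section numbers are the e-print's).
[AoyamaEtAl2006] T. Aoyama, M. Hayakawa, T. Kinoshita, M. Nio, Nucl. Phys. B 740 (2006) 138 = arXiv:hep-ph/0512288.
§5.1 «Definition and diagram representation» (p0017:L31–L70): «A q-type self-energy-like diagram of 2nth order is given by a path 𝒫 consisting of
lepton lines … with n photon lines attached to the path at their both ends; there is no closed lepton loop. … Here we consider only one-particle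
irreducible (1PI) diagrams. We denote 2n vertices as v_j (j = 0, …, (2n−1)) … The vertices v_j sequentially lie on the path 𝒫 as v_0, …, v_{2n−1} … A
lepton line is denoted as l_k (k = 1, …, (2n−1)) which runs from a vertex v_k to another vertex v_{k−1}. A photon line which connects two vertices
v_{i_k} and v_{j_k}, is denoted as h_k (k = a, b, …), where label k is taken to be an alphabet. … A q-type diagram 𝒢 is uniquely specified by the set
of n photon lines, i.e., the set of pairs of vertices». §5.4 (p0018:L16–L20): «A q-type diagram is 1PI if and only if for each lepton line l_k, there
exists at least one photon line that steps over the lepton line, i.e., two end points of photon line, (v_i, v_j), satisfy v_i ≤ v_{k−1} and v_j ≥ v_k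
simultaneously.» §6 (p0019:L3–L12): «it is required in the renormalization process to pick up all the 1PI subdiagrams that have overall ultraviolet
(UV) divergence. … there are two types of UV divergent subdiagrams in q-type diagrams in QED, namely, the lepton self-energy-like subdiagram, and the
vertex subdiagram. Every subtraction term … corresponds to the Zimmermann's forest». §6.1 «UV divergent subdiagrams» (p0019:L24–L60): «a subdiagram of
these types of a q-type diagram corresponds to a single segment of the path, and it is specified by the indices of two end-point vertices. Therefore,
to obtain all the divergent subdiagrams of a q-type diagram we have only to find every possible pair of indices [i, j], 0 ≤ i < j ≤ (2n−1) that
satisfies the following two conditions: … The number of 'floating' photon line (only either one of the two endpoints of the photon line lies on the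
segment [i, j]) is zero (for self-energy-like subdiagram) or one (for vertex subdiagram). And, It is one-particle irreducible, i.e., it stays connected
when any one of the lepton lines that belong to the subdiagram is eliminated. The second condition is satisfied when for every lepton line,
l_{i+1}, …, l_j, there is at least one photon line that belongs to the subdiagram (both endpoints of it lie between v_i and v_j) which steps over the
lepton line. The photon line h_k = (v_{i_k}, v_{j_k}) steps over the lepton line l_s = (v_{s−1}, v_s) when i ≤ i_k ≤ s−1 and s ≤ j_k ≤ j
simultaneously.» §4.1 (p0015:L58–L79) and §6.2 «Forests» (p0019:L68–L100): «disjoint if S_a and S_b do not share any vertices nor lines …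
overlapping if S_a and S_b share some vertices and lines though one is not completely included in the other. nested if S_a ⊂ S_b or S_a ⊃ S_b. For
the q-type diagrams, the inclusion relation is mapped to that of two segments. The relation between two subdiagrams represented by S_a = [i_a, j_a]
and S_b = [i_b, j_b] is one of the following (assuming that i_a ≤ i_b): disjoint if j_a < i_b, overlapping if i_a < i_b ≤ j_a < j_b, nested if
i_a ≤ i_b and j_b ≤ j_a. A forest is defined as such a set of subdiagrams that any two of its elements are not overlapping with each other … it is
sufficient to consider only the 'normal' forests which do not contain the diagram 𝒢 itself.»
[Rivasseau1991] V. Rivasseau, *From Perturbative to Constructive Renormalization* (Princeton UP 1991), §II.1 (chunk p0057) «disjoint here means not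
only no line but also no vertex in common»; §II.3 (chunks p0080–p0081) «E(g) being the set of external lines of g internal in G».

TYPING. Vertices `v_0, …, v_m` are `Fin (m+1)` (`m = 2n − 1` for a diagram of order 2n; nothing below uses parity). Lines `Line m P = Fin m ⊕ P`:
`Sum.inl k` is the lepton line joining `v_k` and `v_{k+1}` (AHKN's `l_{k+1}`), `Sum.inr c` the photon labelled `c : P`. «The set of pairs of
vertices» is encoded by the LABEL MAP `w : Fin (m+1) → P` (vertex ↦ the photon attached there — the familiar word notation `abab`, `abba`, … of the
cell's Set-V families: the j-th letter is the photon at `v_j`); `ends w l` = the endpoints of `l` (for a photon: all vertices carrying its label).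
`segment w i j` = the subdiagram «specified by the indices of two end-point vertices»: every line all of whose endpoints lie in `[v_i, v_j]` («both
endpoints of it lie between v_i and v_j»); `lines w` = the whole diagram `G` (= `segment w 0 m`); `externalLines w s` = Rivasseau's `E(s)` = the
lines of `G` not in `s` with an endpoint at a vertex of `s`; `floating w i j` = the 'floating' photons; `OnePI` = the printed steps-over criterion;
`IsUVSubdiagram` = «0 ≤ i < j», floating ≤ 1, 1PI, not `G`; `uvSubdiagrams w` = the admissible family `A` of the K-forest formula. No hypothesis on
`w` is needed anywhere (for a genuine pairing — every label at exactly two vertices — `lines w = univ`, `lines_eq_univ`).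
PROVED: the line-set dictionary of segments (`inl_mem_segment`, `inr_mem_segment`, `segment_subset_iff` = «nested», `disjoint_segment_iff` = «disjoint
if j_a < i_b» (no common VERTEX), `overlap_segment_iff` = «overlapping if i_a < i_b ≤ j_a < j_b», for segments CLOSED at both ends — both end-point
photons internal, which the 1PI criterion forces: `IsUVSubdiagram.closed`); the external-line formula the cell's tables use (`inl_mem_externalLines_segment`:
the two adjacent lepton lines; `inr_mem_externalLines_segment`: the floating photons); and the MAIN THEOREM `subgraphSystem_of_closed` (H1–H6 of
`Rivasseau1991.SubgraphSystem` for `G = lines w`, `ext = externalLines w` and ANY family of closed segments — H3 «line-disjoint ⇒ vertex-disjoint» is the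
one place closedness enters), whence `subgraphSystem_uvSubdiagrams`, `classification_qtype`, `forestSum_eq_sum_safe_qtype` and
`sum_orderedNegProd_eq_sum_safe_qtype`: Lemma II.3.1, Lemma II.3.2 and (II.3.19) (commuting and ordered operators) for every q-type diagram, every
subfamily `A ⊆ uvSubdiagrams w` and every `pos`. Sanity: the families of `abab` and `abba` are the cell's tables (V12a, V23b; S2b) by `decide`.
NOT CLAIMED: the equivalence of the steps-over criterion with graph-theoretic bridgelessness (AHKN state it; we take the printed criterion as the
definition), anything about amplitudes, K-operations or which segments the cell's scheme actually subtracts (any subfamily is covered).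
-/

namespace Literature.MathematicalPhysics.QuantumFieldTheory.AoyamaEtAl2006

open Finset Zimmermann1969 Rivasseau1991

/-! ## The model (AHKN 2006 §5.1, §6.1) -/

/-- The lines of a q-type diagram on the vertices `v_0, …, v_m`: `Sum.inl k` (`k : Fin m`) is the lepton line joining `v_k` and `v_{k+1}` (AHKN's
`l_{k+1}`: «A lepton line is denoted as l_k … which runs from a vertex v_k to another vertex v_{k−1}»), `Sum.inr c` is the photon line with label `c`
(«denoted as h_k (k = a, b, …), where label k is taken to be an alphabet»). [cite: AoyamaEtAl2006, §5.1 «Definition and diagram representation»] -/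
abbrev Line (m : ℕ) (P : Type*) := Fin m ⊕ P

variable {m : ℕ} {P : Type*} [DecidableEq P] [Fintype P]

section Model

variable (w : Fin (m + 1) → P)

/-- Endpoints of a line: the lepton line `inl k` joins `v_k, v_{k+1}`; the photon `inr c` is attached at every vertex carrying the label `c` («A
photon line which connects two vertices v_{i_k} and v_{j_k} … is also represented by the pair of two endpoints»; the diagram «is uniquely specified by
the set of n photon lines, i.e., the set of pairs of vertices» — here the label map `w`). [cite: AoyamaEtAl2006, §5.1] -/
def ends : Line m P → Finset (Fin (m + 1))
  | .inl k => {k.castSucc, k.succ}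
  | .inr c => univ.filter fun v => w v = c

/-- The line set of the whole diagram `G`: all lepton lines and the photons that occur in `w`. [cite: AoyamaEtAl2006, §5.1] -/
def lines : Finset (Line m P) := univ.filter fun l => (ends w l).Nonempty

/-- The subdiagram of the segment `[v_i, v_j]`: «a subdiagram … corresponds to a single segment of the path, and it is specified by the indices of two
end-point vertices» — the lepton lines `l_{i+1}, …, l_j` and every photon «both endpoints of [which] lie between v_i and v_j», i.e. every line all
of whose endpoints lie in the segment. [cite: AoyamaEtAl2006, §6.1 «UV divergent subdiagrams»] -/
def segment (i j : Fin (m + 1)) : Finset (Line m P) := univ.filter fun l => (ends w l).Nonempty ∧ ends w l ⊆ Icc i j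

/-- The vertices of a line set (union of endpoints). [cite: AoyamaEtAl2006, §4.1 («share no vertices nor lines»)] -/
def vertices (s : Finset (Line m P)) : Finset (Fin (m + 1)) := s.biUnion (ends w)

/-- Rivasseau's `E(s)`: «the set of external lines of s internal in G» — the lines of `G` not in `s` attached to a vertex of `s`.
[cite: Rivasseau1991, §II.3 (definition of E(g) after eq. (II.3.5))] -/
def externalLines (s : Finset (Line m P)) : Finset (Line m P) :=
  (lines w \ s).filter fun l => ¬ Disjoint (ends w l) (vertices w s)

/-- The 'floating' photons of `[v_i, v_j]`: «only either one of the two endpoints of the photon line lies on the segment [i, j]» (a label occurring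
both inside and outside the segment). [cite: AoyamaEtAl2006, §6.1] -/
def floating (i j : Fin (m + 1)) : Finset P :=
  univ.filter fun c => (∃ v, w v = c ∧ v ∈ Icc i j) ∧ ∃ v, w v = c ∧ v ∉ Icc i j

/-- The printed 1PI criterion for the segment `[v_i, v_j]`: «for every lepton line, l_{i+1}, …, l_j, there is at least one photon line that belongs to
the subdiagram (both endpoints of it lie between v_i and v_j) which steps over the lepton line. The photon line h_k = (v_{i_k}, v_{j_k}) steps over
the lepton line l_s = (v_{s−1}, v_s) when i ≤ i_k ≤ s−1 and s ≤ j_k ≤ j simultaneously.» (lepton `inl k` = `l_{k+1}` = `(v_k, v_{k+1})`).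
[cite: AoyamaEtAl2006, §6.1 and §5.4] -/
def OnePI (i j : Fin (m + 1)) : Prop :=
  ∀ k : Fin m, (Sum.inl k : Line m P) ∈ segment w i j →
    ∃ c : P, (Sum.inr c : Line m P) ∈ segment w i j ∧ ∃ a b : Fin (m + 1), w a = c ∧ w b = c ∧ (a : ℕ) ≤ k ∧ (k : ℕ) + 1 ≤ b

/-- `OnePI` is decidable (finite quantifiers). [folklore] -/
instance instDecidableOnePI (i j : Fin (m + 1)) : Decidable (OnePI w i j) := by
  unfold OnePI; infer_instance

/-- UV-divergent subdiagram `[i, j]`: «every possible pair of indices [i, j], 0 ≤ i < j ≤ (2n−1)» with «The number of 'floating' photon line … zero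
(for self-energy-like subdiagram) or one (for vertex subdiagram)» and «one-particle irreducible», excluding «the diagram 𝒢 itself» (normal forests).
[cite: AoyamaEtAl2006, §6.1–§6.2] -/
def IsUVSubdiagram (i j : Fin (m + 1)) : Prop :=
  i < j ∧ (floating w i j).card ≤ 1 ∧ OnePI w i j ∧ ¬ (i = 0 ∧ j = Fin.last m)

/-- `IsUVSubdiagram` is decidable. [folklore] -/
instance instDecidableIsUVSubdiagram (i j : Fin (m + 1)) : Decidable (IsUVSubdiagram w i j) := by
  unfold IsUVSubdiagram; infer_instance

/-- The admissible family of the K-forest formula: the line sets of all UV-divergent subdiagrams of the q-type diagram `w`.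
[cite: AoyamaEtAl2006, §6.1–§6.2] -/
def uvSubdiagrams : Finset (Finset (Line m P)) :=
  ((univ : Finset (Fin (m + 1) × Fin (m + 1))).filter fun p => IsUVSubdiagram w p.1 p.2).image fun p => segment w p.1 p.2

/-- A segment CLOSED at both ends: `i < j` and the photons at the end-point vertices `v_i`, `v_j` belong to the subdiagram (what the 1PI criterion
gives at the two outermost lepton lines, `IsUVSubdiagram.closed`; it is all that H3 below needs). [cite: AoyamaEtAl2006, §6.1] -/
def Closed (i j : Fin (m + 1)) : Prop :=
  i < j ∧ (Sum.inr (w i) : Line m P) ∈ segment w i j ∧ (Sum.inr (w j) : Line m P) ∈ segment w i j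

end Model

/-! ## The line-set dictionary of segments -/

section Basic

variable {w : Fin (m + 1) → P} {i j i' j' : Fin (m + 1)}

omit [Fintype P] in
/-- Endpoints of a lepton line. [cite: AoyamaEtAl2006, §5.1] -/
@[simp] theorem mem_ends_inl {k : Fin m} {v : Fin (m + 1)} : v ∈ ends w (Sum.inl k) ↔ (v : ℕ) = k ∨ (v : ℕ) = k + 1 := by
  simp only [ends, mem_insert, mem_singleton, Fin.ext_iff, Fin.val_castSucc, Fin.val_succ]

omit [Fintype P] in
/-- Endpoints of a photon line. [cite: AoyamaEtAl2006, §5.1] -/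
@[simp] theorem mem_ends_inr {c : P} {v : Fin (m + 1)} : v ∈ ends w (Sum.inr c) ↔ w v = c := by
  simp only [ends, mem_filter, mem_univ, true_and]

/-- Membership in `G`. [cite: AoyamaEtAl2006, §5.1] -/
theorem mem_lines {l : Line m P} : l ∈ lines w ↔ (ends w l).Nonempty := by
  simp only [lines, mem_filter, mem_univ, true_and]

/-- Every lepton line is a line of `G`. [cite: AoyamaEtAl2006, §5.1] -/
theorem inl_mem_lines (k : Fin m) : (Sum.inl k : Line m P) ∈ lines w :=
  mem_lines.2 ⟨k.castSucc, mem_ends_inl.2 (Or.inl (Fin.val_castSucc k))⟩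

/-- For a genuine pairing word (every label occurs) `G` is the set of ALL lines. [cite: AoyamaEtAl2006, §5.1] -/
theorem lines_eq_univ (hw : ∀ c, ∃ v, w v = c) : lines w = univ := by
  ext l
  simp only [mem_univ, iff_true]
  rcases l with k | c
  · exact inl_mem_lines k
  · obtain ⟨v, hv⟩ := hw c
    exact mem_lines.2 ⟨v, mem_ends_inr.2 hv⟩

/-- Membership in a segment: a line with at least one endpoint, all endpoints in `[v_i, v_j]`. [cite: AoyamaEtAl2006, §6.1] -/
theorem mem_segment {l : Line m P} :
    l ∈ segment w i j ↔ (ends w l).Nonempty ∧ ∀ v ∈ ends w l, (i : ℕ) ≤ v ∧ (v : ℕ) ≤ j := by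
  simp only [segment, mem_filter, mem_univ, true_and, subset_iff, mem_Icc, Fin.le_iff_val_le_val]

/-- The lepton line `(v_k, v_{k+1})` belongs to `[v_i, v_j]` iff `i ≤ k` and `k + 1 ≤ j` («l_{i+1}, …, l_j»). [cite: AoyamaEtAl2006, §6.1] -/
theorem inl_mem_segment {k : Fin m} : (Sum.inl k : Line m P) ∈ segment w i j ↔ (i : ℕ) ≤ k ∧ (k : ℕ) + 1 ≤ j := by
  rw [mem_segment]
  constructor
  · rintro ⟨-, h⟩
    have h1 := h k.castSucc (mem_ends_inl.2 (Or.inl (Fin.val_castSucc k)))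
    have h2 := h k.succ (mem_ends_inl.2 (Or.inr (Fin.val_succ k)))
    simp only [Fin.val_castSucc, Fin.val_succ] at h1 h2
    omega
  · rintro ⟨h1, h2⟩
    refine ⟨⟨k.castSucc, mem_ends_inl.2 (Or.inl (Fin.val_castSucc k))⟩, fun v hv => ?_⟩
    rcases mem_ends_inl.1 hv with hv | hv <;> omega

/-- A photon belongs to `[v_i, v_j]` iff it occurs and all its endpoints lie in the segment («both endpoints of it lie between v_i and v_j»).
[cite: AoyamaEtAl2006, §6.1] -/
theorem inr_mem_segment {c : P} :
    (Sum.inr c : Line m P) ∈ segment w i j ↔ (∃ v, w v = c) ∧ ∀ v, w v = c → (i : ℕ) ≤ v ∧ (v : ℕ) ≤ j := by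
  simp only [mem_segment, Finset.Nonempty, mem_ends_inr]

/-- Segments are subdiagrams of `G`. [cite: AoyamaEtAl2006, §6.1] -/
theorem segment_subset_lines : segment w i j ⊆ lines w := fun _ hl => mem_lines.2 (mem_segment.1 hl).1

/-- The segment `[v_0, v_m]` is the whole diagram. [cite: AoyamaEtAl2006, §6.2 («the diagram 𝒢 itself»)] -/
theorem segment_eq_lines (hi : (i : ℕ) = 0) (hj : (j : ℕ) = m) : segment w i j = lines w := by
  ext l
  rw [mem_segment, mem_lines]
  exact ⟨fun h => h.1, fun h => ⟨h, fun v _ => by have := v.is_lt; omega⟩⟩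

/-- A segment with `i < j` contains the lepton line `(v_i, v_{i+1})`, so it is nonempty. [cite: AoyamaEtAl2006, §6.1] -/
theorem segment_nonempty (hij : i < j) : (segment w i j).Nonempty := by
  have hij' := Fin.lt_def.1 hij
  have hjm := j.is_lt
  obtain ⟨k, hk⟩ : ∃ k : Fin m, (k : ℕ) = i := ⟨⟨i, by omega⟩, rfl⟩
  exact ⟨Sum.inl k, inl_mem_segment.2 ⟨by omega, by omega⟩⟩

/-- The vertices of a segment with `i < j` are exactly `v_i, …, v_j`. [cite: AoyamaEtAl2006, §6.1] -/
theorem mem_vertices_segment (hij : i < j) {v : Fin (m + 1)} : v ∈ vertices w (segment w i j) ↔ (i : ℕ) ≤ v ∧ (v : ℕ) ≤ j := by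
  have hij' := Fin.lt_def.1 hij
  have hjm := j.is_lt
  rw [vertices, mem_biUnion]
  constructor
  · rintro ⟨l, hl, hv⟩
    exact (mem_segment.1 hl).2 v hv
  · rintro ⟨h1, h2⟩
    by_cases hvj : (v : ℕ) < j
    · obtain ⟨k, hk⟩ : ∃ k : Fin m, (k : ℕ) = v := ⟨⟨v, by omega⟩, rfl⟩
      exact ⟨Sum.inl k, inl_mem_segment.2 ⟨by omega, by omega⟩, mem_ends_inl.2 (Or.inl hk.symm)⟩
    · obtain ⟨k, hk⟩ : ∃ k : Fin m, (k : ℕ) + 1 = j := ⟨⟨j - 1, by omega⟩, Nat.sub_add_cancel (by omega)⟩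
      exact ⟨Sum.inl k, inl_mem_segment.2 ⟨by omega, by omega⟩, mem_ends_inl.2 (Or.inr (by omega))⟩

/-- Membership in `E([v_i, v_j])`: a line of `G` outside the segment with an endpoint in it. [cite: Rivasseau1991, §II.3 (definition of E(g))] -/
theorem mem_externalLines_segment (hij : i < j) {l : Line m P} :
    l ∈ externalLines w (segment w i j) ↔ l ∈ lines w ∧ l ∉ segment w i j ∧ ∃ v ∈ ends w l, (i : ℕ) ≤ v ∧ (v : ℕ) ≤ j := by
  simp only [externalLines, mem_filter, mem_sdiff, not_disjoint_iff, mem_vertices_segment hij, and_assoc]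

/-- The lepton lines of `E([v_i, v_j])` are the two adjacent ones, `l_i = (v_{i−1}, v_i)` and `l_{j+1} = (v_j, v_{j+1})` (when they exist).
[cite: Rivasseau1991, §II.3 (definition of E(g))] -/
theorem inl_mem_externalLines_segment (hij : i < j) {k : Fin m} :
    (Sum.inl k : Line m P) ∈ externalLines w (segment w i j) ↔ (k : ℕ) + 1 = i ∨ (k : ℕ) = j := by
  have hij' := Fin.lt_def.1 hij
  rw [mem_externalLines_segment hij, inl_mem_segment]
  constructor
  · rintro ⟨-, hn, v, hv, h1, h2⟩
    rcases mem_ends_inl.1 hv with hv | hv <;> omega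
  · intro h
    refine ⟨inl_mem_lines k, by omega, ?_⟩
    rcases h with h | h
    · exact ⟨i, mem_ends_inl.2 (Or.inr h.symm), le_rfl, by omega⟩
    · exact ⟨j, mem_ends_inl.2 (Or.inl h.symm), by omega, le_rfl⟩

/-- The photon lines of `E([v_i, v_j])` are the floating ones (an endpoint inside, an endpoint outside). [cite: AoyamaEtAl2006, §6.1] -/
theorem inr_mem_externalLines_segment (hij : i < j) {c : P} :
    (Sum.inr c : Line m P) ∈ externalLines w (segment w i j) ↔
      (∃ v, w v = c ∧ (i : ℕ) ≤ v ∧ (v : ℕ) ≤ j) ∧ ∃ v, w v = c ∧ ¬ ((i : ℕ) ≤ v ∧ (v : ℕ) ≤ j) := by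
  rw [mem_externalLines_segment hij, inr_mem_segment, mem_lines]
  simp only [Finset.Nonempty, mem_ends_inr, not_and, not_forall, exists_prop]
  constructor
  · rintro ⟨hne, hn, v, hv, h1, h2⟩
    exact ⟨⟨v, hv, h1, h2⟩, hn hne⟩
  · rintro ⟨⟨v, hv, h1, h2⟩, h⟩
    exact ⟨⟨v, hv⟩, fun _ => h, v, hv, h1, h2⟩

/-- The floating photons ARE the photon lines of `E([v_i, v_j])`. [cite: AoyamaEtAl2006, §6.1] -/
theorem mem_floating_iff (hij : i < j) {c : P} : c ∈ floating w i j ↔ (Sum.inr c : Line m P) ∈ externalLines w (segment w i j) := by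
  rw [inr_mem_externalLines_segment hij, floating, mem_filter]
  simp only [mem_univ, true_and, mem_Icc, Fin.le_iff_val_le_val]

/-- `E(s) ⊆ G`. [cite: Rivasseau1991, §II.3] -/
theorem externalLines_subset_lines {s : Finset (Line m P)} : externalLines w s ⊆ lines w :=
  fun _ hl => (mem_sdiff.1 (mem_filter.1 hl).1).1

/-- `E(s) ∩ s = ∅` (H1). [cite: Rivasseau1991, §II.3] -/
theorem externalLines_disjoint {s : Finset (Line m P)} : Disjoint (externalLines w s) s :=
  disjoint_left.2 fun _ hl => (mem_sdiff.1 (mem_filter.1 hl).1).2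

/-- An external line of `s` that is not a line of a larger `s' ⊇ s` is an external line of `s'` (H4). [cite: Rivasseau1991, §II.3] -/
theorem externalLines_sdiff_subset {s s' : Finset (Line m P)} (h : s ⊆ s') : externalLines w s \ s' ⊆ externalLines w s' := by
  intro l hl
  obtain ⟨hl, hls'⟩ := mem_sdiff.1 hl
  obtain ⟨hl1, hl2⟩ := mem_filter.1 hl
  refine mem_filter.2 ⟨mem_sdiff.2 ⟨(mem_sdiff.1 hl1).1, hls'⟩, fun hd => hl2 ?_⟩
  refine disjoint_left.2 fun v hv hvs => disjoint_left.1 hd hv ?_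
  obtain ⟨l', hl', hvl'⟩ := mem_biUnion.1 hvs
  exact mem_biUnion.2 ⟨l', h hl', hvl'⟩

/-- Larger segments give larger subdiagrams. [cite: AoyamaEtAl2006, §6.2 («nested if i_a ≤ i_b and j_b ≤ j_a»)] -/
theorem segment_mono (hi : (i' : ℕ) ≤ i) (hj : (j : ℕ) ≤ j') : segment w i j ⊆ segment w i' j' := by
  intro l hl
  obtain ⟨hne, h⟩ := mem_segment.1 hl
  exact mem_segment.2 ⟨hne, fun v hv => by have := h v hv; omega⟩

/-- **«nested if i_a ≤ i_b and j_b ≤ j_a»**: for `i < j`, `[v_i, v_j] ⊆ [v_{i′}, v_{j′}]` as line sets iff `i′ ≤ i` and `j ≤ j′`.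
[cite: AoyamaEtAl2006, §6.2] -/
theorem segment_subset_iff (hij : i < j) : segment w i j ⊆ segment w i' j' ↔ (i' : ℕ) ≤ i ∧ (j : ℕ) ≤ j' := by
  have hij' := Fin.lt_def.1 hij
  have hjm := j.is_lt
  refine ⟨fun h => ?_, fun h => segment_mono h.1 h.2⟩
  obtain ⟨k, hk⟩ : ∃ k : Fin m, (k : ℕ) = i := ⟨⟨i, by omega⟩, rfl⟩
  obtain ⟨k', hk'⟩ : ∃ k : Fin m, (k : ℕ) + 1 = j := ⟨⟨j - 1, by omega⟩, Nat.sub_add_cancel (by omega)⟩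
  have h1 := inl_mem_segment.1 (h ((inl_mem_segment (k := k)).2 ⟨by omega, by omega⟩))
  have h2 := inl_mem_segment.1 (h ((inl_mem_segment (k := k')).2 ⟨by omega, by omega⟩))
  omega

/-- Two closed segments `[i, j]`, `[i′, j′]` with `i ≤ i′ ≤ j` share a line: the lepton line `(v_{i′}, v_{i′+1})` if `i′ < j`, the photon at the
common end-point vertex `v_j = v_{i′}` if `i′ = j` — the step «line-disjoint ⇒ vertex-disjoint». [cite: AoyamaEtAl2006, §6.2] -/
theorem not_disjoint_segment_of_le (hc : Closed w i j) (hc' : Closed w i' j') (h1 : (i : ℕ) ≤ i') (h2 : (i' : ℕ) ≤ j) :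
    ¬ Disjoint (segment w i j) (segment w i' j') := by
  have hij := Fin.lt_def.1 hc.1
  have hij' := Fin.lt_def.1 hc'.1
  have hjm := j'.is_lt
  intro hd
  by_cases hlt : (i' : ℕ) < j
  · obtain ⟨k, hk⟩ : ∃ k : Fin m, (k : ℕ) = i' := ⟨⟨i', by omega⟩, rfl⟩
    exact disjoint_left.1 hd ((inl_mem_segment (k := k)).2 ⟨by omega, by omega⟩)
      ((inl_mem_segment (k := k)).2 ⟨by omega, by omega⟩)
  · have heq : i' = j := Fin.ext (by omega)
    have h3 : (Sum.inr (w j) : Line m P) ∈ segment w i' j' := by rw [← heq]; exact hc'.2.1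
    exact disjoint_left.1 hd hc.2.2 h3

/-- **«disjoint if j_a < i_b»** (for closed segments): line-disjointness is VERTEX-disjointness — `[i, j]` and `[i′, j′]` have no line in common iff
`j < i′` or `j′ < i` («disjoint if S_a and S_b do not share any vertices nor lines»; Rivasseau: «not only no line but also no vertex in common»).
[cite: AoyamaEtAl2006, §6.2] -/
theorem disjoint_segment_iff (hc : Closed w i j) (hc' : Closed w i' j') :
    Disjoint (segment w i j) (segment w i' j') ↔ (j : ℕ) < i' ∨ (j' : ℕ) < i := by
  constructor
  · intro hd
    by_contra hn
    rcases le_total (i : ℕ) i' with h | h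
    · exact not_disjoint_segment_of_le hc hc' h (by omega) hd
    · exact not_disjoint_segment_of_le hc' hc h (by omega) hd.symm
  · intro h
    refine disjoint_left.2 fun l hl hl' => ?_
    obtain ⟨⟨v, hv⟩, hb⟩ := mem_segment.1 hl
    have h1 := hb v hv
    have h2 := (mem_segment.1 hl').2 v hv
    omega

/-- **«overlapping if i_a < i_b ≤ j_a < j_b»** (for closed segments, in Zimmermann's sense `Overlap` = neither nested nor line-disjoint).
[cite: AoyamaEtAl2006, §6.2] -/
theorem overlap_segment_iff (hc : Closed w i j) (hc' : Closed w i' j') :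
    Overlap (segment w i j) (segment w i' j') ↔
      ((i : ℕ) < i' ∧ (i' : ℕ) ≤ j ∧ (j : ℕ) < j') ∨ ((i' : ℕ) < i ∧ (i : ℕ) ≤ j' ∧ (j' : ℕ) < j) := by
  have hij := Fin.lt_def.1 hc.1
  have hij' := Fin.lt_def.1 hc'.1
  rw [Overlap, segment_subset_iff hc.1, segment_subset_iff hc'.1, disjoint_segment_iff hc hc']
  omega

/-- The printed 1PI criterion at the two outermost lepton lines makes the end-point photons internal: a UV-divergent segment is closed.
[cite: AoyamaEtAl2006, §6.1] -/
theorem IsUVSubdiagram.closed (h : IsUVSubdiagram w i j) : Closed w i j := by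
  obtain ⟨hij, -, hpi, -⟩ := h
  have hij' := Fin.lt_def.1 hij
  have hjm := j.is_lt
  refine ⟨hij, ?_, ?_⟩
  · obtain ⟨k, hk⟩ : ∃ k : Fin m, (k : ℕ) = i := ⟨⟨i, by omega⟩, rfl⟩
    obtain ⟨c, hc, a, b, hac, -, hak, -⟩ := hpi k ((inl_mem_segment (k := k)).2 ⟨by omega, by omega⟩)
    have hia : a = i := Fin.ext (by have := ((inr_mem_segment.1 hc).2 a hac).1; omega)
    have hwi : w i = c := hia ▸ hac
    rw [hwi]
    exact hc
  · obtain ⟨k, hk⟩ : ∃ k : Fin m, (k : ℕ) + 1 = j := ⟨⟨j - 1, by omega⟩, Nat.sub_add_cancel (by omega)⟩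
    obtain ⟨c, hc, a, b, -, hbc, -, hkb⟩ := hpi k ((inl_mem_segment (k := k)).2 ⟨by omega, by omega⟩)
    have hjb : b = j := Fin.ext (by have := ((inr_mem_segment.1 hc).2 b hbc).2; omega)
    have hwj : w j = c := hjb ▸ hbc
    rw [hwj]
    exact hc

/-- Membership in the admissible family. [cite: AoyamaEtAl2006, §6.1] -/
theorem mem_uvSubdiagrams {g : Finset (Line m P)} : g ∈ uvSubdiagrams w ↔ ∃ i j, IsUVSubdiagram w i j ∧ segment w i j = g := by
  simp only [uvSubdiagrams, mem_image, mem_filter, mem_univ, true_and, Prod.exists]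

end Basic

/-! ## H1–H6 for every family of closed segments; the Classification of Forests and (II.3.19) for every q-type diagram -/

section System

variable {w : Fin (m + 1) → P} {i j i' j' : Fin (m + 1)}

/-- H2 against `G`: a proper segment has an external line (an adjacent lepton line). [cite: Rivasseau1991, §II.3 proof of Lemma II.3.1] -/
theorem externalLines_segment_nonempty (hij : i < j) (h : segment w i j ≠ lines w) : (externalLines w (segment w i j)).Nonempty := by
  have hij' := Fin.lt_def.1 hij
  have hjm := j.is_lt
  by_cases hi : 0 < (i : ℕ)
  · obtain ⟨k, hk⟩ : ∃ k : Fin m, (k : ℕ) + 1 = i := ⟨⟨i - 1, by omega⟩, Nat.sub_add_cancel hi⟩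
    exact ⟨Sum.inl k, (inl_mem_externalLines_segment hij).2 (Or.inl hk)⟩
  · by_cases hj : (j : ℕ) < m
    · exact ⟨Sum.inl ⟨j, hj⟩, (inl_mem_externalLines_segment hij).2 (Or.inr rfl)⟩
    · exact absurd (segment_eq_lines (by omega) (by omega)) h

/-- H2 against a larger segment: if `[i, j] ⊊ [i′, j′]` then an adjacent lepton line of `[i, j]` lies in `[i′, j′]` («there must exist a line … which is
an external line of d_k and is contained in d_{k+1}»). [cite: Rivasseau1991, §II.3 proof of Lemma II.3.1] -/
theorem externalLines_inter_nonempty_of_ssubset (hij : i < j) (hij' : i' < j') (h : segment w i j ⊂ segment w i' j') :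
    (externalLines w (segment w i j) ∩ segment w i' j').Nonempty := by
  have h1 := (segment_subset_iff hij).1 h.1
  have hv := Fin.lt_def.1 hij
  have hv' := Fin.lt_def.1 hij'
  have hjm := j'.is_lt
  have hne : ¬ ((i' : ℕ) = i ∧ (j : ℕ) = j') := fun he => h.2 (segment_mono he.1.symm.le he.2.symm.le)
  by_cases hii : (i' : ℕ) < i
  · obtain ⟨k, hk⟩ : ∃ k : Fin m, (k : ℕ) + 1 = i := ⟨⟨i - 1, by omega⟩, Nat.sub_add_cancel (by omega)⟩
    exact ⟨Sum.inl k, mem_inter.2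
      ⟨(inl_mem_externalLines_segment hij).2 (Or.inl hk), (inl_mem_segment (k := k)).2 ⟨by omega, by omega⟩⟩⟩
  · obtain ⟨k, hk⟩ : ∃ k : Fin m, (k : ℕ) = j := ⟨⟨j, by omega⟩, rfl⟩
    exact ⟨Sum.inl k, mem_inter.2
      ⟨(inl_mem_externalLines_segment hij).2 (Or.inr hk), (inl_mem_segment (k := k)).2 ⟨by omega, by omega⟩⟩⟩

/-- H3: a closed segment line-disjoint from the closed segment `d` contains no external line of `d` («disjoint here means not only no line but also
no vertex in common» holds automatically for these subdiagrams). [cite: Rivasseau1991, §II.1 (definition of forest)] -/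
theorem disjoint_externalLines_of_disjoint (hc : Closed w i j) (hc' : Closed w i' j') (h : Disjoint (segment w i j) (segment w i' j')) :
    Disjoint (segment w i j) (externalLines w (segment w i' j')) := by
  rw [disjoint_segment_iff hc hc'] at h
  refine disjoint_left.2 fun l hl hle => ?_
  obtain ⟨-, -, v, hv, h1, h2⟩ := (mem_externalLines_segment hc'.1).1 hle
  have h3 := (mem_segment.1 hl).2 v hv
  omega

/-- H6: of two overlapping closed segments, each contains an external line of the other («since g is connected, g − g′ must contain a line l which is
internal for g and external for g′» — here an adjacent lepton line of `g′`). [cite: Rivasseau1991, §II.3 proof of Lemma II.3.2 (a)] -/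
theorem inter_externalLines_nonempty_of_overlap (hc : Closed w i j) (hc' : Closed w i' j') (h : Overlap (segment w i j) (segment w i' j')) :
    (segment w i j ∩ externalLines w (segment w i' j')).Nonempty := by
  rw [overlap_segment_iff hc hc'] at h
  have hjm := j.is_lt
  have hjm' := j'.is_lt
  rcases h with ⟨h1, h2, h3⟩ | ⟨h1, h2, h3⟩
  · obtain ⟨k, hk⟩ : ∃ k : Fin m, (k : ℕ) + 1 = i' := ⟨⟨i' - 1, by omega⟩, Nat.sub_add_cancel (by omega)⟩
    exact ⟨Sum.inl k, mem_inter.2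
      ⟨(inl_mem_segment (k := k)).2 ⟨by omega, by omega⟩, (inl_mem_externalLines_segment hc'.1).2 (Or.inl hk)⟩⟩
  · obtain ⟨k, hk⟩ : ∃ k : Fin m, (k : ℕ) = j' := ⟨⟨j', by omega⟩, rfl⟩
    exact ⟨Sum.inl k, mem_inter.2
      ⟨(inl_mem_segment (k := k)).2 ⟨by omega, by omega⟩, (inl_mem_externalLines_segment hc'.1).2 (Or.inr hk)⟩⟩

/-- **MAIN THEOREM.** For every q-type diagram `w` and every family `A` of closed segments, `(G, E, A) = (lines w, externalLines w, A)` is a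
`Rivasseau1991.SubgraphSystem`: H1 `E(g) ∩ g = ∅`, H2 connectedness, H3 line-disjoint ⇒ no external line in common (vertex-disjointness), H4, H5,
H6 overlap ⇒ `g ∩ E(g′) ≠ ∅` — the six structural facts Rivasseau's printed proofs of Lemma II.3.1 and Lemma II.3.2 (a) use.
[cite: Rivasseau1991, §II.1 and §II.3 (proofs of Lemmas II.3.1–II.3.2); AoyamaEtAl2006 §6.1–§6.2] -/
theorem subgraphSystem_of_closed (w : Fin (m + 1) → P) {A : Finset (Finset (Line m P))}
    (hA : ∀ g ∈ A, ∃ i j, Closed w i j ∧ segment w i j = g) : SubgraphSystem (lines w) (externalLines w) A where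
  nonempty g hg := by
    obtain ⟨i, j, hc, rfl⟩ := hA g hg
    exact segment_nonempty hc.1
  subset g hg := by
    obtain ⟨i, j, -, rfl⟩ := hA g hg
    exact segment_subset_lines
  ext_subset _ _ := externalLines_subset_lines
  ext_disjoint _ _ := externalLines_disjoint
  ext_inter_nonempty d hd d' hd' hdd' := by
    obtain ⟨i, j, hc, rfl⟩ := hA d hd
    rcases mem_insert.1 hd' with rfl | hd'A
    · rw [inter_eq_left.2 externalLines_subset_lines]
      exact externalLines_segment_nonempty hc.1 hdd'.ne
    · obtain ⟨i', j', hc', rfl⟩ := hA d' hd'A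
      exact externalLines_inter_nonempty_of_ssubset hc.1 hc'.1 hdd'
  disjoint_ext_of_disjoint h hh d hd hdis := by
    obtain ⟨i, j, hc, rfl⟩ := hA h hh
    obtain ⟨i', j', hc', rfl⟩ := hA d hd
    exact disjoint_externalLines_of_disjoint hc hc' hdis
  ext_sdiff_subset _ _ _ _ hgk := externalLines_sdiff_subset hgk
  inter_ext_nonempty_of_overlap g hg g' hg' hov := by
    obtain ⟨i, j, hc, rfl⟩ := hA g hg
    obtain ⟨i', j', hc', rfl⟩ := hA g' hg'
    exact inter_externalLines_nonempty_of_overlap hc hc' hov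

/-- Every subfamily of the UV-divergent subdiagrams of a q-type diagram is a subgraph system (in particular the whole K-forest family).
[cite: AoyamaEtAl2006, §6.1–§6.2; Rivasseau1991 §II.3] -/
theorem subgraphSystem_of_subset_uvSubdiagrams (w : Fin (m + 1) → P) {A : Finset (Finset (Line m P))} (hA : A ⊆ uvSubdiagrams w) :
    SubgraphSystem (lines w) (externalLines w) A :=
  subgraphSystem_of_closed w fun g hg => by
    obtain ⟨i, j, h, rfl⟩ := mem_uvSubdiagrams.1 (hA hg)
    exact ⟨i, j, h.closed, rfl⟩

/-- The K-forest family of every q-type diagram is a subgraph system. [cite: AoyamaEtAl2006, §6.1–§6.2; Rivasseau1991 §II.3] -/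
theorem subgraphSystem_uvSubdiagrams (w : Fin (m + 1) → P) : SubgraphSystem (lines w) (externalLines w) (uvSubdiagrams w) :=
  subgraphSystem_of_subset_uvSubdiagrams w subset_rfl

variable {ι : Type*} [LinearOrder ι]

/-- **Rivasseau's Classification of Forests (Lemma II.3.1 + Lemma II.3.2) for every q-type diagram, every admissible subfamily `A` of its
UV-divergent subdiagrams and every index `pos` on its lines** (e.g. the position in a Hepp ordering): the safe-part projector classifies `forests A`
into the Boolean intervals `[𝐅, 𝐅 ∪ 𝐇_μ(𝐅)]`, `𝐅` safe — no hypothesis left. [cite: Rivasseau1991, Lemma II.3.2 (II.3.12a)–(II.3.12b)] -/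
theorem classification_qtype (w : Fin (m + 1) → P) {A : Finset (Finset (Line m P))} (hA : A ⊆ uvSubdiagrams w) (pos : Line m P → ι) :
    ∀ F ∈ forests A, safePart (dangerousPart (lines w) (externalLines w) pos) F = F →
      Disjoint F (dangerousExt (forests A) (dangerousPart (lines w) (externalLines w) pos) F) ∧
        ∀ U, (U ∈ forests A ∧ safePart (dangerousPart (lines w) (externalLines w) pos) U = F) ↔
          (F ⊆ U ∧ U ⊆ F ∪ dangerousExt (forests A) (dangerousPart (lines w) (externalLines w) pos) F) :=
  classification_of_system pos (subgraphSystem_of_subset_uvSubdiagrams w hA)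

/-- **(II.3.19) for every q-type diagram** (commuting subtraction symbols): the K-forest sum over the forests of any admissible subfamily `A` equals
the sum over the SAFE forests of `Π_{g∈𝐅}(−t_g) · Π_{h∈𝐇_μ(𝐅)}(1 − t_h)`, for every index `pos`. [cite: Rivasseau1991, eq. (II.3.19)] -/
theorem forestSum_eq_sum_safe_qtype {R : Type*} [CommRing R] (w : Fin (m + 1) → P) {A : Finset (Finset (Line m P))}
    (hA : A ⊆ uvSubdiagrams w) (pos : Line m P → ι) (t : Finset (Line m P) → R) :
    forestSum A t =
      ∑ F ∈ (forests A).filter (fun F => safePart (dangerousPart (lines w) (externalLines w) pos) F = F),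
        (∏ γ ∈ F, (-t γ)) * ∏ h ∈ dangerousExt (forests A) (dangerousPart (lines w) (externalLines w) pos) F, (1 - t h) :=
  forestSum_eq_sum_safe_of_system pos (subgraphSystem_of_subset_uvSubdiagrams w hA) t

/-- **(II.3.19) for every q-type diagram, ORDERED non-commuting operators** (AHKN's K-products along any duplicate-free enumeration `l` of the
subdiagrams, e.g. outer first): the sum over all forests of the ordered products equals the sum over the safe forests of the ordered class products
(`−t` on `𝐅`, `1 − t` on `𝐇_μ(𝐅)`). [cite: Rivasseau1991, eq. (II.3.19); AoyamaEtAl2006 §4.2] -/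
theorem sum_orderedNegProd_eq_sum_safe_qtype {R : Type*} [Ring R] (w : Fin (m + 1) → P) {A : Finset (Finset (Line m P))}
    (hA : A ⊆ uvSubdiagrams w) (pos : Line m P → ι) (l : List (Finset (Line m P))) (hl : l.Nodup)
    (hAl : ∀ U ∈ forests A, U ⊆ l.toFinset) (t : Finset (Line m P) → R) :
    ∑ U ∈ forests A, orderedNegProd l t U =
      ∑ F ∈ (forests A).filter (fun F => safePart (dangerousPart (lines w) (externalLines w) pos) F = F),
        orderedClassProd l t F (F ∪ dangerousExt (forests A) (dangerousPart (lines w) (externalLines w) pos) F) :=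
  sum_orderedNegProd_eq_sum_safe_of_system pos (subgraphSystem_of_subset_uvSubdiagrams w hA) l hl hAl t

end System

/-! ## Sanity: the fourth-order words `abab` and `abba` (the cell's tables V12a, V23b and S2b) -/

/-- The crossed fourth-order diagram `abab` (`m = 3`, labels `a = 0`, `b = 1`): its UV-divergent subdiagrams are the two vertex subdiagrams
`[v_0, v_2] = {l_1, l_2, a}` and `[v_1, v_3] = {l_2, l_3, b}`, with external lines `{l_3, b}` and `{l_1, a}` — the cell's table (V12a: lines 1, 2, a,
E = 3, b; V23b: lines 2, 3, b, E = 1, a). [cite: AoyamaEtAl2006, §6.1] -/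
theorem uvSubdiagrams_abab :
    uvSubdiagrams (![0, 1, 0, 1] : Fin 4 → Fin 2) =
      {{Sum.inl 0, Sum.inl 1, Sum.inr 0}, {Sum.inl 1, Sum.inl 2, Sum.inr 1}} ∧
    externalLines (![0, 1, 0, 1] : Fin 4 → Fin 2) {Sum.inl 0, Sum.inl 1, Sum.inr 0} = {Sum.inl 2, Sum.inr 1} ∧
    externalLines (![0, 1, 0, 1] : Fin 4 → Fin 2) {Sum.inl 1, Sum.inl 2, Sum.inr 1} = {Sum.inl 0, Sum.inr 0} := by
  refine ⟨by decide, by decide, by decide⟩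

/-- The uncrossed fourth-order diagram `abba`: its only UV-divergent subdiagram is the self-energy `[v_1, v_2] = {l_2, b}` with external lines
`{l_1, l_3}` (the cell's S2b: lines 2, b, E = 1, 3); `[v_0, v_2]` is not 1PI and `[v_0, v_3]` is `G`. [cite: AoyamaEtAl2006, §6.1] -/
theorem uvSubdiagrams_abba :
    uvSubdiagrams (![0, 1, 1, 0] : Fin 4 → Fin 2) = {{Sum.inl 1, Sum.inr 1}} ∧
    externalLines (![0, 1, 1, 0] : Fin 4 → Fin 2) {Sum.inl 1, Sum.inr 1} = {Sum.inl 0, Sum.inl 2} := by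
  refine ⟨by decide, by decide⟩

end Literature.MathematicalPhysics.QuantumFieldTheory.AoyamaEtAl2006
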